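import Literature.NumberTheory.EllipticCurves.Rank1Residual.Typed.VisibilityCertificate
import Literature.NumberTheory.EllipticCurves.CongruenceVisibilityRefinedCertificate
import HarnessLib

/-!
# Rank `0`, any class: `BSD(E,p)` from a visible element of `Ш(E)[p]` — the REFINED count (multiplicative places free) (cell `b2b-bsdres`)

HONEST FRAMING (run/shared/lean/b2b/bsd-rank1-residual/, verbatim): the goal of the cell is to
DELETE the COMBINATION-SHAPED residual classes for ALL analytic-rank `≤ 1` elliptic curves over `ℚ`
— "full BSD formula for every rank `≤ 1` curve in class C" assembled STRICTLY from published
theorems — so that the rank-`≤ 1` remainder becomes exactly the CONSTRUCTION-SHAPED classes, which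
are TYPED (missing-input `Prop`s), NOT attempted. This is not "finishing BSD".

Theorems only (no definition, no new named fact; prover x11a gen 10). Sequel to
`Typed/VisibilityCertificate.lean` (x11a gen 9: `bsdp_of_wuthrich_of_congr`, the per-curve lever
"rank-`0` pair with `p² ‖ #Ш_an` + a `p`-CONGRUENT CURVE OF RANK `≥ 2` with no `ℚ_v`-rational
`p`-torsion on `S` ⇒ `BSD(E,p)`", from Wuthrich Prop. 21 + Cassels–Tate + GZK + modularity and the
kernel visibility count `exists_sha_ne_zero_of_congr_of_rank`). Here the count is the REFINED one of
`CongruenceVisibilityComparison.lean` / `CongruenceVisibilityMultiplicative.lean` /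
`CongruenceVisibilityMultiplicativeTwisted.lean` (x11a gen 10): the local Kummer conditions of `E`
and of the partner `E'` are COMPARED place by place instead of being paid for, and they AGREE (index
`ι_v = 1`) at every place where both curves have multiplicative reduction of the same type — split
with `#E(ℚ_v)[p] ≤ p`, or (split or non-split alike) with `μ_p(ℚ_v) = 1`, i.e. `v = p` or
`v ≢ 1 (mod p)` — by Tate's uniformisation. Consequence for the certificate shape: the partner needs
only **rank `≥ 1`** plus, at each place of `S`, one of (i) `v ≠ p` and `E'(ℚ_v)[p] = 0`,
(ii)/(iii) the multiplicative agreement; the level `p` itself (for an X11 pair, `p ‖ N`) and the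
multiplicative primes `ℓ ≡ ±1 (mod p)` carrying local `p`-torsion — at `p = 3`, ALL multiplicative
primes — no longer cost a unit of rank each.

* `bsdp_of_wuthrich_of_congr_of_mult` — all places of `S` free, partner of rank `≥ 1` (image
  surjective-or-Borel, `p ∤ #E(ℚ)` explicit); `…_of_mult_of_surj` — surjective image;
* `bsdp_of_wuthrich_of_congr_of_places` — the general refined shape: PAY at the places of `T ⊆ S`
  (`∏_{v ∈ T} #E'(ℚ_v)[p] · #(ℤ_v/p) < p^{rank E'}`; a curve with GOOD reduction at `p` pays
  `p · #E'(ℚ_p)[p]` there), free kinds (i)/(ii)/(iii) elsewhere; `…_of_places_of_surj`.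

Binders: published `hCT` (Cassels–Tate), `hW` (Wuthrich 2014 Prop. 21), `hGZK`, `hmod`, and the two
Tate-uniformisation facts `hU` (`Silverman1994_thmV53_tateUniformisation`, ATAEC V.3.1/V.5.3) and
`hU2` (`Silverman1994_thmV53_corV54_tateUniformisation`, ATAEC V.5.2 (c)/V.5.3/Cor. V.5.4) — all
PUBLISHED. NOT class theorems (per-curve partner data); no label changes; the lane certifies.
Engine-1 census (gen-10 `numerics/refine_p3.py` on the gen-9 partner data, N < 2·10⁴, `p = 3`,
rank `0`, `9 ‖ #Ш_an`, `ρ̄` surjective): of 558 curves, 203 certified by the gen-9 shape, 475 by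
the refined shape with the same partners (plain/stabilised Sturm already passed), 52 more pending a
stabilised Sturm test, 31 without a usable partner below conductor `5·10⁵`.

References: Cremona–Mazur 2000 §3, Table 1 [CremonaMazur2000]; Agashe–Stein 2002 Thm. 3.1
[AgasheStein2002]; Wuthrich 2014 Prop. 21 [Wuthrich2014]; Silverman AEC X.4.14 [SilvermanAEC2009];
Silverman ATAEC V.3.1, V.5.2–5.4 [SilvermanATAEC1994]; cell files `Typed/VisibilityCertificate.lean`,
`b2b-bsdres-x11a/REPORT-g10.md`.
-/

noncomputable section

open scoped Classical

open WeierstrassCurve Literature.NumberTheory.EllipticCurves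
  Literature.NumberTheory.EllipticCurves.Rank1Residual
  Literature.NumberTheory.EllipticCurves.Wuthrich2014
open NumberField IsDedekindDomain

namespace Literature.NumberTheory.EllipticCurves.Rank1Residual.Typed

variable (W : WeierstrassCurve ℚ) [W.IsElliptic] [W.IsGloballyMinimal] (p : ℕ) [Fact p.Prime]

/-- **Rank `0`, odd non-additive `p`, surjective-or-Borel image, `ord_p #Ш_an ≤ 2`: `BSD(E,p)` from
PUBLISHED theorems plus a `p`-CONGRUENT CURVE OF RANK `≥ 1` with agreeing local conditions**
(refined visibility count; general form, `p ∤ #E(ℚ)` explicit). Per-curve data: `W'`, `θ`,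
`hrank : 1 ≤ rank E'(ℚ)`, `S`, `hS`, and `hplaces`: every `v ∈ S` satisfies (i) `v ≠ p` and
`E'(ℚ_v)[p] = 0`, or (ii) both curves split multiplicative at `v` and `#E(ℚ_v)[p] ≤ p`, or
(iii) both curves multiplicative at `v`, `γ(E) = r² γ(E')` in `ℚ_v` (same split/non-split type)
and `μ_p(ℚ_v) = 1`. Published binders `hCT`, `hW`, `hGZK`, `hmod`, `hU`, `hU2`. NOT a class
theorem. [cite: Wuthrich2014, Prop. 21 (p. 400)] [cite: SilvermanAEC2009, Thm. X.4.14]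
[cite: CremonaMazur2000, §3 and Table 1] [cite: AgasheStein2002, Thm. 3.1]
[cite: SilvermanATAEC1994, Ch. V Thm. 3.1, Lemma 5.2, Thm. 5.3, Cor. 5.4] -/
theorem bsdp_of_wuthrich_of_congr_of_mult (hCT : exists_casselsTate_pairing (K := ℚ))
    (hW : sha_dvd_analyticSha) (hGZK : rank_eq_analyticRank_of_analyticRank_le_one)
    (hmod : hasEntireLFunction_rat) (hU : Silverman1994_thmV53_tateUniformisation.{0})
    (hU2 : Silverman1994_thmV53_corV54_tateUniformisation.{0}) (hp : p ≠ 2)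
    (hr : W.analyticRank = 0)
    (hadd : ¬ ((W.baseChange ℚ_[p]).minimal ℤ_[p]).HasAdditiveReduction ℤ_[p])
    (himg : ¬ W.HasIrreducibleModPGaloisRep p ∨ W.HasSurjectiveModNGaloisRep p)
    (hcop : (Nat.card W.toAffine.Point).Coprime p)
    {q : ℚ} (hq : shaAn W = (q : ℂ)) (hv : padicValRat p q ≤ 2)
    (W' : WeierstrassCurve ℚ) [W'.IsElliptic]
    (θ : geomTorsion W' (p : ℤ) ≃+ geomTorsion W (p : ℤ))
    (hθ : ∀ (σ : Field.absoluteGaloisGroup ℚ) (P : geomTorsion W' (p : ℤ)), θ (σ • P) = σ • θ P)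
    (hrank : 1 ≤ W'.mordellWeilRank) (S : Finset (HeightOneSpectrum (𝓞 ℚ)))
    (hS : ∀ v : HeightOneSpectrum (𝓞 ℚ), v ∉ S →
      W.HasGoodReductionAt v ∧ W'.HasGoodReductionAt v ∧ (p : 𝓞 ℚ) ∉ v.asIdeal)
    (hplaces : ∀ v ∈ S,
      ((p : 𝓞 ℚ) ∉ v.asIdeal ∧ Nat.card (nsmulAddMonoidHom p :
          (W'.baseChange (v.adicCompletion ℚ)).toAffine.Point →+ _).ker = 1) ∨
      (W.HasSplitMultiplicativeReductionAt v ∧ W'.HasSplitMultiplicativeReductionAt v ∧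
        Nat.card (nsmulAddMonoidHom p :
          (W.baseChange (v.adicCompletion ℚ)).toAffine.Point →+ _).ker ≤ p) ∨
      (W.HasMultiplicativeReductionAt v ∧ W'.HasMultiplicativeReductionAt v ∧
        (∃ r : v.adicCompletion ℚ, algebraMap ℚ (v.adicCompletion ℚ) (-(W.c₄ / W.c₆)) =
          r ^ 2 * algebraMap ℚ (v.adicCompletion ℚ) (-(W'.c₄ / W'.c₆))) ∧
        (∀ ζ : v.adicCompletion ℚ, ζ ^ p = 1 → ζ = 1))) :
    BSDp W p := by
  haveI : Finite W.toAffine.Point := finite_point_of_analyticRank_eq_zero W hGZK hr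
  exact bsdp_of_wuthrich_of_casselsTate_of_dvd W p hCT hW hGZK hmod hp hr hadd himg hq hv
    (dvd_shaOrder_of_exists_torsion W p
      (W.exists_sha_ne_zero_of_congr_of_rank_of_mult hU hU2 hp W' θ hθ S hS ‹_› hcop hrank
        hplaces))

/-- **Rank `0`, odd non-additive `p`, SURJECTIVE `ρ̄_{E,p}`, `ord_p #Ш_an ≤ 2`: `BSD(E,p)` from
PUBLISHED theorems plus a `p`-congruent curve of rank `≥ 1` with agreeing local conditions** —
`p ∤ #E(ℚ)` is automatic (surjective ⇒ irreducible ⇒ no rational `p`-torsion). Covers every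
rank-`0` residue pair of the cell with surjective image and `p² ‖ #Ш_an` at a good or multiplicative
`p` (X11 at `p = 3` and at `p ≥ 5`, X6/X7/X8 at `p = 3`), given a partner with the refined local
data. NOT a class theorem. [cite: Wuthrich2014, Prop. 21 (p. 400)]
[cite: SilvermanAEC2009, Thm. X.4.14] [cite: CremonaMazur2000, §3 and Table 1]
[cite: Mazur1977, Ch. III §5, p. 157] [cite: SilvermanATAEC1994, Ch. V Thm. 5.3, Cor. 5.4] -/
theorem bsdp_of_wuthrich_of_congr_of_mult_of_surj (hCT : exists_casselsTate_pairing (K := ℚ))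
    (hW : sha_dvd_analyticSha) (hGZK : rank_eq_analyticRank_of_analyticRank_le_one)
    (hmod : hasEntireLFunction_rat) (hU : Silverman1994_thmV53_tateUniformisation.{0})
    (hU2 : Silverman1994_thmV53_corV54_tateUniformisation.{0}) (hp : p ≠ 2)
    (hr : W.analyticRank = 0)
    (hadd : ¬ ((W.baseChange ℚ_[p]).minimal ℤ_[p]).HasAdditiveReduction ℤ_[p])
    (hsurj : Surj W p) {q : ℚ} (hq : shaAn W = (q : ℂ)) (hv : padicValRat p q ≤ 2)
    (W' : WeierstrassCurve ℚ) [W'.IsElliptic]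
    (θ : geomTorsion W' (p : ℤ) ≃+ geomTorsion W (p : ℤ))
    (hθ : ∀ (σ : Field.absoluteGaloisGroup ℚ) (P : geomTorsion W' (p : ℤ)), θ (σ • P) = σ • θ P)
    (hrank : 1 ≤ W'.mordellWeilRank) (S : Finset (HeightOneSpectrum (𝓞 ℚ)))
    (hS : ∀ v : HeightOneSpectrum (𝓞 ℚ), v ∉ S →
      W.HasGoodReductionAt v ∧ W'.HasGoodReductionAt v ∧ (p : 𝓞 ℚ) ∉ v.asIdeal)
    (hplaces : ∀ v ∈ S,
      ((p : 𝓞 ℚ) ∉ v.asIdeal ∧ Nat.card (nsmulAddMonoidHom p :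
          (W'.baseChange (v.adicCompletion ℚ)).toAffine.Point →+ _).ker = 1) ∨
      (W.HasSplitMultiplicativeReductionAt v ∧ W'.HasSplitMultiplicativeReductionAt v ∧
        Nat.card (nsmulAddMonoidHom p :
          (W.baseChange (v.adicCompletion ℚ)).toAffine.Point →+ _).ker ≤ p) ∨
      (W.HasMultiplicativeReductionAt v ∧ W'.HasMultiplicativeReductionAt v ∧
        (∃ r : v.adicCompletion ℚ, algebraMap ℚ (v.adicCompletion ℚ) (-(W.c₄ / W.c₆)) =
          r ^ 2 * algebraMap ℚ (v.adicCompletion ℚ) (-(W'.c₄ / W'.c₆))) ∧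
        (∀ ζ : v.adicCompletion ℚ, ζ ^ p = 1 → ζ = 1))) :
    BSDp W p := by
  haveI : Finite W.toAffine.Point := finite_point_of_analyticRank_eq_zero W hGZK hr
  haveI : NeZero (p : ℚ) := ⟨by exact_mod_cast (Fact.out : p.Prime).ne_zero⟩
  have hirr : Irr W p := hasIrreducibleModPGaloisRep_of_hasSurjectiveModNGaloisRep W p hsurj
  exact bsdp_of_wuthrich_of_congr_of_mult W p hCT hW hGZK hmod hU hU2 hp hr hadd (Or.inr hsurj)
    (coprime_natCard_point_of_irr W p hirr) hq hv W' θ hθ hrank S hS hplaces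

/-- **Rank `0`, odd non-additive `p`, surjective-or-Borel image, `ord_p #Ш_an ≤ 2`: `BSD(E,p)` from
PUBLISHED theorems plus a `p`-congruent curve — the general refined shape: PAY at the places of
`T ⊆ S`, FREE elsewhere.** Per-curve data: `W'`, `θ`, `S`, `hS`, `T ⊆ S` with
`∏_{v ∈ T} #E'(ℚ_v)[p] · #(ℤ_v/p) < p^{rank E'(ℚ)}` (over `ℚ`: `#(ℤ_v/p) = p` for `v = p`, `1`
otherwise — a curve with good reduction at `p` must put `p ∈ T`), and `hplaces`: every
`v ∈ S \ T` of kind (i)/(ii)/(iii). Published binders `hCT`, `hW`, `hGZK`, `hmod`, `hU`, `hU2`.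
NOT a class theorem. [cite: Wuthrich2014, Prop. 21 (p. 400)] [cite: SilvermanAEC2009, Thm. X.4.14]
[cite: CremonaMazur2000, §3 and Table 1] [cite: AgasheStein2002, Thm. 3.1]
[cite: SilvermanATAEC1994, Ch. V Thm. 3.1, Lemma 5.2, Thm. 5.3, Cor. 5.4] -/
theorem bsdp_of_wuthrich_of_congr_of_places (hCT : exists_casselsTate_pairing (K := ℚ))
    (hW : sha_dvd_analyticSha) (hGZK : rank_eq_analyticRank_of_analyticRank_le_one)
    (hmod : hasEntireLFunction_rat) (hU : Silverman1994_thmV53_tateUniformisation.{0})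
    (hU2 : Silverman1994_thmV53_corV54_tateUniformisation.{0}) (hp : p ≠ 2)
    (hr : W.analyticRank = 0)
    (hadd : ¬ ((W.baseChange ℚ_[p]).minimal ℤ_[p]).HasAdditiveReduction ℤ_[p])
    (himg : ¬ W.HasIrreducibleModPGaloisRep p ∨ W.HasSurjectiveModNGaloisRep p)
    (hcop : (Nat.card W.toAffine.Point).Coprime p)
    {q : ℚ} (hq : shaAn W = (q : ℂ)) (hv : padicValRat p q ≤ 2)
    (W' : WeierstrassCurve ℚ) [W'.IsElliptic]
    (θ : geomTorsion W' (p : ℤ) ≃+ geomTorsion W (p : ℤ))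
    (hθ : ∀ (σ : Field.absoluteGaloisGroup ℚ) (P : geomTorsion W' (p : ℤ)), θ (σ • P) = σ • θ P)
    (S T : Finset (HeightOneSpectrum (𝓞 ℚ))) (hTS : T ⊆ S)
    (hS : ∀ v : HeightOneSpectrum (𝓞 ℚ), v ∉ S →
      W.HasGoodReductionAt v ∧ W'.HasGoodReductionAt v ∧ (p : 𝓞 ℚ) ∉ v.asIdeal)
    (hT : (∏ v ∈ T, Nat.card (nsmulAddMonoidHom p :
        (W'.baseChange (v.adicCompletion ℚ)).toAffine.Point →+ _).ker *
        Nat.card (v.adicCompletionIntegers ℚ ⧸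
          Ideal.span {(p : v.adicCompletionIntegers ℚ)})) < p ^ W'.mordellWeilRank)
    (hplaces : ∀ v ∈ S, v ∉ T →
      ((p : 𝓞 ℚ) ∉ v.asIdeal ∧ Nat.card (nsmulAddMonoidHom p :
          (W'.baseChange (v.adicCompletion ℚ)).toAffine.Point →+ _).ker = 1) ∨
      (W.HasSplitMultiplicativeReductionAt v ∧ W'.HasSplitMultiplicativeReductionAt v ∧
        Nat.card (nsmulAddMonoidHom p :
          (W.baseChange (v.adicCompletion ℚ)).toAffine.Point →+ _).ker ≤ p) ∨
      (W.HasMultiplicativeReductionAt v ∧ W'.HasMultiplicativeReductionAt v ∧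
        (∃ r : v.adicCompletion ℚ, algebraMap ℚ (v.adicCompletion ℚ) (-(W.c₄ / W.c₆)) =
          r ^ 2 * algebraMap ℚ (v.adicCompletion ℚ) (-(W'.c₄ / W'.c₆))) ∧
        (∀ ζ : v.adicCompletion ℚ, ζ ^ p = 1 → ζ = 1))) :
    BSDp W p := by
  haveI : Finite W.toAffine.Point := finite_point_of_analyticRank_eq_zero W hGZK hr
  exact bsdp_of_wuthrich_of_casselsTate_of_dvd W p hCT hW hGZK hmod hp hr hadd himg hq hv
    (dvd_shaOrder_of_exists_torsion W p
      (W.exists_sha_ne_zero_of_congr_of_places hU hU2 hp W' θ hθ S T hTS hS ‹_› hcop hT hplaces))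

/-- **Rank `0`, odd non-additive `p`, SURJECTIVE `ρ̄_{E,p}`, `ord_p #Ш_an ≤ 2`: `BSD(E,p)` from
PUBLISHED theorems plus a `p`-congruent curve — general refined shape (pay at `T`, free elsewhere)**;
`p ∤ #E(ℚ)` automatic. NOT a class theorem. [cite: Wuthrich2014, Prop. 21 (p. 400)]
[cite: SilvermanAEC2009, Thm. X.4.14] [cite: CremonaMazur2000, §3 and Table 1]
[cite: Mazur1977, Ch. III §5, p. 157] [cite: SilvermanATAEC1994, Ch. V Thm. 5.3, Cor. 5.4] -/
theorem bsdp_of_wuthrich_of_congr_of_places_of_surj (hCT : exists_casselsTate_pairing (K := ℚ))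
    (hW : sha_dvd_analyticSha) (hGZK : rank_eq_analyticRank_of_analyticRank_le_one)
    (hmod : hasEntireLFunction_rat) (hU : Silverman1994_thmV53_tateUniformisation.{0})
    (hU2 : Silverman1994_thmV53_corV54_tateUniformisation.{0}) (hp : p ≠ 2)
    (hr : W.analyticRank = 0)
    (hadd : ¬ ((W.baseChange ℚ_[p]).minimal ℤ_[p]).HasAdditiveReduction ℤ_[p])
    (hsurj : Surj W p) {q : ℚ} (hq : shaAn W = (q : ℂ)) (hv : padicValRat p q ≤ 2)
    (W' : WeierstrassCurve ℚ) [W'.IsElliptic]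
    (θ : geomTorsion W' (p : ℤ) ≃+ geomTorsion W (p : ℤ))
    (hθ : ∀ (σ : Field.absoluteGaloisGroup ℚ) (P : geomTorsion W' (p : ℤ)), θ (σ • P) = σ • θ P)
    (S T : Finset (HeightOneSpectrum (𝓞 ℚ))) (hTS : T ⊆ S)
    (hS : ∀ v : HeightOneSpectrum (𝓞 ℚ), v ∉ S →
      W.HasGoodReductionAt v ∧ W'.HasGoodReductionAt v ∧ (p : 𝓞 ℚ) ∉ v.asIdeal)
    (hT : (∏ v ∈ T, Nat.card (nsmulAddMonoidHom p :
        (W'.baseChange (v.adicCompletion ℚ)).toAffine.Point →+ _).ker *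
        Nat.card (v.adicCompletionIntegers ℚ ⧸
          Ideal.span {(p : v.adicCompletionIntegers ℚ)})) < p ^ W'.mordellWeilRank)
    (hplaces : ∀ v ∈ S, v ∉ T →
      ((p : 𝓞 ℚ) ∉ v.asIdeal ∧ Nat.card (nsmulAddMonoidHom p :
          (W'.baseChange (v.adicCompletion ℚ)).toAffine.Point →+ _).ker = 1) ∨
      (W.HasSplitMultiplicativeReductionAt v ∧ W'.HasSplitMultiplicativeReductionAt v ∧
        Nat.card (nsmulAddMonoidHom p :
          (W.baseChange (v.adicCompletion ℚ)).toAffine.Point →+ _).ker ≤ p) ∨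
      (W.HasMultiplicativeReductionAt v ∧ W'.HasMultiplicativeReductionAt v ∧
        (∃ r : v.adicCompletion ℚ, algebraMap ℚ (v.adicCompletion ℚ) (-(W.c₄ / W.c₆)) =
          r ^ 2 * algebraMap ℚ (v.adicCompletion ℚ) (-(W'.c₄ / W'.c₆))) ∧
        (∀ ζ : v.adicCompletion ℚ, ζ ^ p = 1 → ζ = 1))) :
    BSDp W p := by
  haveI : Finite W.toAffine.Point := finite_point_of_analyticRank_eq_zero W hGZK hr
  haveI : NeZero (p : ℚ) := ⟨by exact_mod_cast (Fact.out : p.Prime).ne_zero⟩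
  have hirr : Irr W p := hasIrreducibleModPGaloisRep_of_hasSurjectiveModNGaloisRep W p hsurj
  exact bsdp_of_wuthrich_of_congr_of_places W p hCT hW hGZK hmod hU hU2 hp hr hadd (Or.inr hsurj)
    (coprime_natCard_point_of_irr W p hirr) hq hv W' θ hθ S T hTS hS hT hplaces

end Literature.NumberTheory.EllipticCurves.Rank1Residual.Typed
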